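import Summits.NavierStokesRegularity.NavierStokesRegularity.Theses.PlaneEnergyCeiling
import Summits.NavierStokesRegularity.NavierStokesRegularity.Theorems.HardyPointSinkHardyAncientLimit
import Summits.NavierStokesRegularity.NavierStokesRegularity.Theorems.TypeICertificateLadderNoBlowupToClay
import Literature.Analysis.FluidPDE.PoincareBall

/-!
# `PlanarEnergyZoomA` (stmt-NavierStokesRegularity-16915) — line `hardy-sink-transfer`

Crux-strategist skeleton (crux protocol, (a) NEW LINE) for the rank-5 crux of route
`PlaneEnergyCeiling`.  TRANSFER lens: the solved sibling is route `HardyPointSink`, whose items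
`BlowupHasSingularPoint` (stmt-9116), `HardyAncientLimit` (stmt-9138) and the frame `NoBlowupToClay`
(stmt-0055) are PROVED in tree (`hardyPointSink_blowupHasSingularPoint_proof`,
`hardyAncientLimit_proof`, `typeICertificateLadder_noBlowupToClay_proof`).  In that chain the local
HARDY bound `∫_{B(xs,r₀)} |u|²/|x−x₀| ≤ K` is used in exactly three places, each time only through the
CKN scaled energy `A(Q(z,r)) = sup_t r⁻¹ ∫_{B(x,r)} |u|²` it dominates:
(i) Type I at the vertex (`HardyAncientLimit.typeIBound_vertex_lt_top`: `cknAEss_le_of_hardy` +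
`albrittonBarker2019_lemma_2_6_holds`), (ii) the Morrey growth `∫_{B(0,m)}|w|² ≤ I m` that kills the
parasitic drift of the bounded weak blow-up limit (`oseenMild_of_boundedWeak_ancient`), (iii) the
transported bound itself (`hardy_limit_le`, scale invariance + Fatou).  The PLANAR kinetic energy
`E(u;R,c) = ∫_{R({x₂=c})} |u|² dA` dominates `A` in the same way (a ball of radius `r` lies in a slab
of width `2r`: `∫_{B_r}|u|² ≤ 2 r M`, item `ScaledEnergyOfPlanar` of the route), is invariant under
the Navier–Stokes scaling, translations and rotations, rescales by `ν⁻²` under the viscosity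
normalisation, and passes to pointwise limits of continuous slices by Fatou on each plane.  Hence the
HardyPointSink chain transfers verbatim with "Hardy" replaced by "planar", and the output is upgraded
for free to the KNSS duality class (`HardyAncientLimit.isBoundedAncientMildSolution_of_oseen`, proved)
with joint smoothness (`exists_isClassicalNSSolutionOn_Iio_of_oseen`, proved).

Stubs (each a genuine lemma; sizes M / M–L / L):

* `stub_localClaySingularA` (M) — PER-DATUM LOCAL CLAY THEORY WITH A SINGULAR POINT: for a Clay datum
  `u₀` and `ν > 0`, if Clay (A) fails for `u₀` then some classical solution `(u,p)` on `[0,T)`,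
  Leray–Hopf from `u 0 = u₀`, has a backward singular point `(T, xs)` (essentially unbounded on every
  `Q_r(T,xs)`).  This is lines 80–219 + 260–265 of the PROVED
  `typeICertificateLadder_noBlowupToClay_proof` read per datum (Kato maximal time; global case by
  `clay_solution_of_hasGlobalKatoSolution_holds`; finite case: singular point of the maximal Kato
  solution `lemarieRieusset_singular_point_of_blowup_holds`, patched Tao-class classical
  representative `exists_classical_of_isTaoSolutionOn_family`, Leray graft
  `leray_existence_R3_holds` + `weak_strong_uniqueness_holds`, transfer of the singularity along the
  a.e. equality `eLpNorm_parabolicCylinder_eq_top_of_ae_eq`).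
* `stub_planarVertexPackage` (M–L) — VISCOSITY NORMALISATION + VERTEX ZOOM + PLANAR TYPE I: from a
  classical Leray–Hopf solution (any `ν`) with a singular point `(T,xs)` and planar energies `≤ M` on
  `[0,T)`, the pair `u₁ = c • stPull c² c (νT) xs v`, `p₁ = …` (`v = timeRescale ν⁻¹ ν⁻¹ u`,
  `c = min 1 √(νT)`) is classical on `]-1,0[` with `ν = 1`, not regular at the origin, of finite
  Albritton–Barker Type I quantity on `Q(0,1/2)` (gauged pressure), with planar energies `≤ M/ν²`.
  First lemma: `cknA r z v ≤ 2M/ν²` from the planar bound (= `ScaledEnergyOfPlanar`, stmt-16860), then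
  `typeIBound_vertex_lt_top` verbatim with `cknAEss_le_of_hardy` replaced, `typeIBound_nsZoom`,
  `eLpNorm_timeRescale_eq_top`, `eLpNorm_zoom_parabolicCylinder_eq_top`, and the planar scaling law.
* `stub_planarAncientOfZoomed` (L, hardest) — THE ANCIENT LIMIT IN THE ZOOMED FRAME CARRYING THE PLANAR
  BOUND: `HardyAncientLimit.exists_ancient_of_zoomed` with `hardy_limit_le` replaced by a planar Fatou
  lemma and the Morrey input of `oseenMild_of_boundedWeak_ancient` taken from the planar bound of the
  limit; output in the KNSS duality class, measurable, jointly smooth, non-trivial at a negative time.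

Tools (PROVED in this file, sorry-free): `lintegral_ball_sq_le_of_planar` / `cknA_le_of_planar` — the planar
bound dominates the energy of balls and CKN's scaled energy `A` (this is route item `ScaledEnergyOfPlanar`,
stmt-16860 — candidate proof attached as evidence on that item, file ScaledEnergyOfPlanarCandidate.lean); `planar_smul_stPull_le` — the planar bound is invariant under
`γ • stPull β γ t₀ x₀` for every rotation and offset (change of variables on the plane,
`PoincareBall.lintegral_comp_smul_add`); `planar_le_of_tendsto` — a planar bound common to continuous
fields passes to their pointwise limit (Fatou on the plane).  With these, EVERY ingredient of the
transfer that is not already a theorem of the HardyPointSink files is proved in this workfile; the stubs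
are assembly work over charted proofs.

Glue `PlanarEnergyZoomA_of` (sorry-free): ¬(A) ⇒ singular classical Leray–Hopf solution from `u₀`
(stub 1) ⇒ the route hypothesis gives its planar bound `M` on `[0,T)` (made `≥ 0`) ⇒ zoomed package
(stub 2) ⇒ ancient limit (stub 3).

Disproof used: none exists yet (`Cruxes/PlanarEnergyZoomA/Disproof.lean` not written at registration).
-/

noncomputable section

-- the summit and its single problem share the name `NavierStokesRegularity` (D-0017 nested layout)
set_option linter.dupNamespace false

open Set Function Filter Topology MeasureTheory Metric
open scoped ENNReal NNReal

namespace Summit.NavierStokesRegularity.NavierStokesRegularity.Cruxes.PlanarEnergyZoomA.HardySinkTransfer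

open Literature.Analysis.FluidPDE
open Summit.NavierStokesRegularity.NavierStokesRegularity.Theses.PlaneEnergyCeiling

local notation "E3" => EuclideanSpace ℝ (Fin 3)
local notation "E2" => EuclideanSpace ℝ (Fin 2)

/-! ## Tools (PROVED here: planar ⇒ scaled energy (= item ScaledEnergyOfPlanar), planar scaling law, planar Fatou) -/

/-- The coordinate plane embedding at height `c`: `y ↦ (y 0, y 1, c)`. -/
def planeEmb (c : ℝ) (y : E2) : E3 := WithLp.toLp 2 ![y 0, y 1, c]

theorem planeEmb_apply_two (c : ℝ) (y : E2) : planeEmb c y 2 = c := by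
  simp [planeEmb]

theorem continuous_planeEmb (c : ℝ) : Continuous (planeEmb c) := by
  unfold planeEmb
  refine (PiLp.continuous_toLp 2 _).comp ?_
  refine continuous_pi fun i => ?_
  fin_cases i
  · exact (PiLp.continuous_apply 2 _ 0)
  · exact (PiLp.continuous_apply 2 _ 1)
  · exact continuous_const

/-- The measurable equivalence `E3 ≃ᵐ ℝ × E2`, `x ↦ (x 2, (x 0, x 1))` (offset first). -/
def splitPlane : E3 ≃ᵐ ℝ × E2 :=
  ((MeasurableEquiv.toLp 2 (Fin 3 → ℝ)).symm.trans
    (MeasurableEquiv.piFinSuccAbove (fun _ => ℝ) 2)).trans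
    (MeasurableEquiv.prodCongr (MeasurableEquiv.refl ℝ) (MeasurableEquiv.toLp 2 (Fin 2 → ℝ)))

theorem measurePreserving_splitPlane : MeasurePreserving splitPlane volume volume := by
  have h1 : MeasurePreserving (MeasurableEquiv.toLp 2 (Fin 3 → ℝ)).symm volume volume :=
    EuclideanSpace.volume_preserving_symm_measurableEquiv_toLp (Fin 3)
  have h2 : MeasurePreserving (MeasurableEquiv.piFinSuccAbove (fun _ : Fin 3 => ℝ) 2) volume
      volume :=
    volume_preserving_piFinSuccAbove (fun _ => ℝ) 2
  have h3 : MeasurePreserving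
      (MeasurableEquiv.prodCongr (MeasurableEquiv.refl ℝ) (MeasurableEquiv.toLp 2 (Fin 2 → ℝ)))
      volume volume :=
    (MeasurePreserving.id volume).prod
      (EuclideanSpace.volume_preserving_symm_measurableEquiv_toLp (Fin 2)).symm
  exact (h1.trans h2).trans h3

theorem splitPlane_apply (x : E3) :
    splitPlane x = (x 2, WithLp.toLp 2 (Fin.removeNth 2 (WithLp.ofLp x))) := rfl

theorem splitPlane_planeEmb (c : ℝ) (y : E2) : splitPlane (planeEmb c y) = (c, y) := by
  rw [splitPlane_apply]
  refine Prod.ext (planeEmb_apply_two c y) ?_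
  ext i
  fin_cases i <;> rfl

theorem splitPlane_symm_apply (c : ℝ) (y : E2) : splitPlane.symm (c, y) = planeEmb c y := by
  apply splitPlane.injective
  rw [MeasurableEquiv.apply_symm_apply, splitPlane_planeEmb]

/-- **TOOL 1 — planar bound ⇒ scaled-energy bound on balls** (= item `ScaledEnergyOfPlanar`,
stmt-16860, for the coordinate foliation; the hypothesis is only used at `R = refl`): a ball of
radius `r` lies in a slab of width `2r`, Tonelli over the offset. -/
theorem lintegral_ball_sq_le_of_planar (w : E3 → E3) (hw : Continuous w) {M : ℝ} (hM : 0 ≤ M)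
    (h : ∀ (R : E3 ≃ₗᵢ[ℝ] E3) (c : ℝ),
      ∫⁻ y : E2, ‖w (R (WithLp.toLp 2 ![y 0, y 1, c]))‖ₑ ^ 2 ≤ ENNReal.ofReal M)
    (x₀ : E3) {r : ℝ} (_hr : 0 < r) :
    ∫⁻ x in ball x₀ r, ‖w x‖ₑ ^ 2 ≤ ENNReal.ofReal (2 * r * M) := by
  -- the planar bound on the coordinate planes
  have hc : ∀ c : ℝ, ∫⁻ y : E2, ‖w (planeEmb c y)‖ₑ ^ 2 ≤ ENNReal.ofReal M := fun c => by
    simpa [planeEmb] using h (LinearIsometryEquiv.refl ℝ E3) c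
  -- the slab containing the ball
  set I : Set ℝ := Ioo (x₀ 2 - r) (x₀ 2 + r) with hI
  set S : Set E3 := {x | x 2 ∈ I} with hS
  have hball : ball x₀ r ⊆ S := by
    intro x hx
    rw [mem_ball_iff_norm] at hx
    have h2 : ‖(x - x₀) 2‖ ≤ ‖x - x₀‖ := PiLp.norm_apply_le (x - x₀) 2
    have h3 : |x 2 - x₀ 2| < r := by
      rw [Real.norm_eq_abs] at h2
      have e : (x - x₀) 2 = x 2 - x₀ 2 := by simp
      rw [e] at h2
      exact h2.trans_lt hx
    rw [abs_lt] at h3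
    show x 2 ∈ I
    exact ⟨by linarith [h3.1], by linarith [h3.2]⟩
  have hcoord : Measurable fun x : E3 => x 2 := (PiLp.continuous_apply 2 _ 2).measurable
  have hSmeas : MeasurableSet S := hcoord measurableSet_Ioo
  -- the integrand
  set G : E3 → ℝ≥0∞ := fun x => ‖w x‖ₑ ^ 2 with hG
  have hGm : Measurable G := (hw.enorm.measurable).pow_const 2
  have hFm : Measurable fun p : ℝ × E2 => S.indicator G (splitPlane.symm p) :=
    (hGm.indicator hSmeas).comp splitPlane.symm.measurable
  calc ∫⁻ x in ball x₀ r, G x ≤ ∫⁻ x in S, G x := lintegral_mono_set hball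
    _ = ∫⁻ x, S.indicator G x := (lintegral_indicator hSmeas G).symm
    _ = ∫⁻ p : ℝ × E2, S.indicator G (splitPlane.symm p) :=
        ((measurePreserving_splitPlane.symm _).lintegral_comp_emb
          splitPlane.symm.measurableEmbedding (S.indicator G)).symm
    _ = ∫⁻ c : ℝ, ∫⁻ y : E2, S.indicator G (splitPlane.symm (c, y)) := by
        rw [Measure.volume_eq_prod]
        exact lintegral_prod _ hFm.aemeasurable
    _ = ∫⁻ c : ℝ, I.indicator (fun c => ∫⁻ y : E2, G (planeEmb c y)) c := by
        refine lintegral_congr fun c => ?_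
        by_cases hcI : c ∈ I
        · rw [indicator_of_mem hcI]
          refine lintegral_congr fun y => ?_
          have hmem : planeEmb c y ∈ S := by
            show planeEmb c y 2 ∈ I
            rw [planeEmb_apply_two]
            exact hcI
          rw [splitPlane_symm_apply, indicator_of_mem hmem]
        · rw [indicator_of_notMem hcI]
          have hzero : ∀ y : E2, S.indicator G (splitPlane.symm (c, y)) = 0 := fun y => by
            have hnot : planeEmb c y ∉ S := by
              show planeEmb c y 2 ∉ I
              rw [planeEmb_apply_two]
              exact hcI
            rw [splitPlane_symm_apply, indicator_of_notMem hnot]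
          simp_rw [hzero]
          exact lintegral_zero
    _ ≤ ∫⁻ c : ℝ, I.indicator (fun _ => ENNReal.ofReal M) c :=
        lintegral_mono fun c => indicator_le_indicator (hc c)
    _ = ENNReal.ofReal M * volume I := lintegral_indicator_const measurableSet_Ioo _
    _ = ENNReal.ofReal (2 * r * M) := by
        rw [hI, Real.volume_Ioo, ← ENNReal.ofReal_mul hM, mul_comm]
        congr 1
        ring


/-- **TOOL 1' — the planar bound dominates CKN's scaled energy `A`** on every parabolic ball whose
times lie in the interval where the planar bound holds (the `cknA` form consumed by
`typeIBound_vertex_lt_top`, replacing `HardyAncientLimit.cknA_le_of_hardy`). -/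
theorem cknA_le_of_planar {S : Set ℝ} {M : ℝ} {u : ℝ → E3 → E3} (hM : 0 ≤ M)
    (hcont : ∀ t ∈ S, Continuous (u t))
    (h : ∀ t ∈ S, ∀ (R : E3 ≃ₗᵢ[ℝ] E3) (c : ℝ),
      ∫⁻ y : E2, ‖u t (R (WithLp.toLp 2 ![y 0, y 1, c]))‖ₑ ^ 2 ≤ ENNReal.ofReal M)
    {r : ℝ} (hr : 0 < r) {z : ℝ × E3} (hz : Ioo (z.1 - r ^ 2) z.1 ⊆ S) :
    Literature.Analysis.FluidPDE.cknA r z u ≤ ENNReal.ofReal (2 * M) := by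
  unfold Literature.Analysis.FluidPDE.cknA
  refine iSup₂_le fun t ht => ?_
  have hb := lintegral_ball_sq_le_of_planar (u t) (hcont t (hz ht)) hM (h t (hz ht)) z.2 hr
  calc (ENNReal.ofReal r)⁻¹ * ∫⁻ x in ball z.2 r, ‖u t x‖ₑ ^ 2
      ≤ (ENNReal.ofReal r)⁻¹ * ENNReal.ofReal (2 * r * M) := by gcongr
    _ = ENNReal.ofReal (2 * M) := by
        rw [show 2 * r * M = r * (2 * M) by ring, ENNReal.ofReal_mul hr.le, ← mul_assoc,
          ENNReal.inv_mul_cancel (by simpa using hr) ENNReal.ofReal_ne_top, one_mul]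

/-- TOOL 2 (planar scaling law; first lemma of the transport): the planar bound is invariant under
the Navier–Stokes scaling + translation `γ • stPull β γ t₀ x₀` (any rotation `R`, any offset). -/
theorem planar_smul_stPull_le {γ : ℝ} (hγ : 0 < γ) (β t₀ : ℝ) (x₀ : E3) (u : ℝ → E3 → E3)
    {S : Set ℝ} {B : ℝ≥0∞}
    (h : ∀ t ∈ S, ∀ (R : E3 ≃ₗᵢ[ℝ] E3) (c : ℝ),
      ∫⁻ y : E2, ‖u t (R (WithLp.toLp 2 ![y 0, y 1, c]))‖ₑ ^ 2 ≤ B)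
    {s : ℝ} (hs : t₀ + β * s ∈ S) (R : E3 ≃ₗᵢ[ℝ] E3) (c : ℝ) :
    ∫⁻ y : E2, ‖(γ • stPull β γ t₀ x₀ u) s (R (WithLp.toLp 2 ![y 0, y 1, c]))‖ₑ ^ 2 ≤ B := by
  -- the in-plane translation `a` and the new offset `c₁`
  set b : E3 := R.symm x₀ with hb
  set a : E2 := WithLp.toLp 2 ![b 0, b 1] with ha
  set c₁ : ℝ := γ * c + b 2 with hc₁
  set G : E2 → ℝ≥0∞ := fun w => ‖u (t₀ + β * s) (R (WithLp.toLp 2 ![w 0, w 1, c₁]))‖ₑ ^ 2 with hG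
  -- pointwise: the rescaled field on the plane `(R, c)` is `γ •` the field on the plane `(R, c₁)`
  have hplane : ∀ y : E2,
      x₀ + γ • (R (WithLp.toLp 2 ![y 0, y 1, c]) : E3) =
        R (WithLp.toLp 2 ![(γ • y + a) 0, (γ • y + a) 1, c₁]) := by
    intro y
    have e : (WithLp.toLp 2 ![(γ • y + a) 0, (γ • y + a) 1, c₁] : E3) =
        γ • (WithLp.toLp 2 ![y 0, y 1, c] : E3) + b := by
      ext i
      fin_cases i <;> simp [ha, hc₁]
    rw [e, map_add, LinearIsometryEquiv.map_smul, hb, LinearIsometryEquiv.apply_symm_apply, add_comm]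
  have hpt : ∀ y : E2,
      ‖(γ • stPull β γ t₀ x₀ u) s (R (WithLp.toLp 2 ![y 0, y 1, c]))‖ₑ ^ 2 =
        ENNReal.ofReal γ ^ 2 * G (γ • y + a) := by
    intro y
    simp only [Pi.smul_apply, stPull_apply, hG]
    rw [hplane y, enorm_smul, mul_pow, Real.enorm_eq_ofReal hγ.le]
  simp_rw [hpt]
  rw [lintegral_const_mul' _ _ (by simp),
    Literature.Analysis.FluidPDE.PoincareBall.lintegral_comp_smul_add G hγ.ne' a,
    finrank_euclideanSpace_fin, ← mul_assoc, ← ENNReal.ofReal_pow hγ.le,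
    ← ENNReal.ofReal_mul (by positivity), abs_of_pos (by positivity),
    mul_inv_cancel₀ (by positivity), ENNReal.ofReal_one, one_mul]
  exact h _ hs R c₁

/-- TOOL 3 (planar Fatou; first lemma of stub 3's transport step `planar_limit_le`): a planar bound
common to continuous fields passes to their pointwise limit. -/
theorem planar_le_of_tendsto (F : ℕ → E3 → E3) (f : E3 → E3) (hF : ∀ j, Continuous (F j))
    (hlim : ∀ x, Tendsto (fun j => F j x) atTop (𝓝 (f x))) {B : ℝ≥0∞}
    (R : E3 ≃ₗᵢ[ℝ] E3) (c : ℝ)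
    (hB : ∀ j, ∫⁻ y : E2, ‖F j (R (WithLp.toLp 2 ![y 0, y 1, c]))‖ₑ ^ 2 ≤ B) :
    ∫⁻ y : E2, ‖f (R (WithLp.toLp 2 ![y 0, y 1, c]))‖ₑ ^ 2 ≤ B := by
  -- the plane embedding
  set g : E2 → E3 := fun y => R (WithLp.toLp 2 ![y 0, y 1, c]) with hg
  have hP : Continuous fun y : E2 => (WithLp.toLp 2 ![y 0, y 1, c] : E3) := by
    refine (PiLp.continuous_toLp 2 _).comp ?_
    refine continuous_pi fun i => ?_
    fin_cases i
    · exact (PiLp.continuous_apply 2 _ 0)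
    · exact (PiLp.continuous_apply 2 _ 1)
    · exact continuous_const
  have hgc : Continuous g := R.continuous.comp hP
  have hmeas : ∀ j, Measurable fun y : E2 => ‖F j (g y)‖ₑ ^ 2 := fun j =>
    (((hF j).comp hgc).enorm.measurable).pow_const 2
  -- pointwise convergence of the integrands
  have hpt : ∀ y : E2, Tendsto (fun j => ‖F j (g y)‖ₑ ^ 2) atTop (𝓝 (‖f (g y)‖ₑ ^ 2)) := fun y =>
    ((ENNReal.continuous_pow 2).tendsto _).comp ((continuous_enorm.tendsto _).comp (hlim (g y)))
  -- Fatou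
  calc ∫⁻ y : E2, ‖f (g y)‖ₑ ^ 2
      = ∫⁻ y : E2, liminf (fun j => ‖F j (g y)‖ₑ ^ 2) atTop :=
        lintegral_congr fun y => ((hpt y).liminf_eq).symm
    _ ≤ liminf (fun j => ∫⁻ y : E2, ‖F j (g y)‖ₑ ^ 2) atTop := lintegral_liminf_le hmeas
    _ ≤ B := Filter.liminf_le_of_frequently_le' (Filter.Frequently.of_forall hB)

/-! ## Stubs -/

/-- STUB 1 — per-datum local Clay theory with a singular point (Kato maximal-time dichotomy;
template: `typeICertificateLadder_noBlowupToClay_proof`, read per datum). -/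
theorem stub_localClaySingularA :
    ∀ (ν : ℝ), 0 < ν → ∀ (u₀ : EuclideanSpace ℝ (Fin 3) → EuclideanSpace ℝ (Fin 3)),
      ContDiff ℝ (⊤ : ℕ∞) u₀ → Literature.Analysis.FluidPDE.NSWave0.IsDivFree u₀ →
      Literature.Analysis.FluidPDE.HasRapidSpatialDecay u₀ →
      ¬ (∃ (u : ℝ → EuclideanSpace ℝ (Fin 3) → EuclideanSpace ℝ (Fin 3))
          (p : ℝ → EuclideanSpace ℝ (Fin 3) → ℝ),
          Literature.Analysis.FluidPDE.IsSmoothOnHalfSpace u ∧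
          Literature.Analysis.FluidPDE.IsSmoothOnHalfSpace p ∧
          Literature.Analysis.FluidPDE.IsNavierStokesSolution ν 0 u₀ u p ∧
          Literature.Analysis.FluidPDE.HasBoundedEnergy u) →
      ∃ T : ℝ, 0 < T ∧ ∃ (u : ℝ → EuclideanSpace ℝ (Fin 3) → EuclideanSpace ℝ (Fin 3))
        (p : ℝ → EuclideanSpace ℝ (Fin 3) → ℝ),
        Literature.Analysis.FluidPDE.IsClassicalNSSolutionOn (Set.Ico 0 T) ν 0 u p ∧
        Literature.Analysis.FluidPDE.IsLerayHopfOn T ν 0 (u 0) u ∧ u 0 = u₀ ∧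
        ∃ xs : EuclideanSpace ℝ (Fin 3), ∀ r : ℝ, 0 < r →
          MeasureTheory.eLpNorm (Function.uncurry u) ⊤ (MeasureTheory.volume.restrict
            (Literature.Analysis.FluidPDE.parabolicCylinder r (T, xs))) = ⊤ := by
  sorry

/-- STUB 2 — viscosity normalisation, vertex zoom and PLANAR Type I: the zoomed-frame package of
`HardyAncientLimit.exists_ancient_of_one` with the Hardy bound replaced by the planar bound
(first lemma: planar ⇒ `cknA ≤ 2M`, i.e. `ScaledEnergyOfPlanar`). -/
theorem stub_planarVertexPackage :
    ∀ (ν T : ℝ), 0 < ν → 0 < T →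
      ∀ (u : ℝ → EuclideanSpace ℝ (Fin 3) → EuclideanSpace ℝ (Fin 3))
        (p : ℝ → EuclideanSpace ℝ (Fin 3) → ℝ),
      Literature.Analysis.FluidPDE.IsClassicalNSSolutionOn (Set.Ico 0 T) ν 0 u p →
      Literature.Analysis.FluidPDE.IsLerayHopfOn T ν 0 (u 0) u →
      ∀ (xs : EuclideanSpace ℝ (Fin 3)), (∀ r : ℝ, 0 < r →
          MeasureTheory.eLpNorm (Function.uncurry u) ⊤ (MeasureTheory.volume.restrict
            (Literature.Analysis.FluidPDE.parabolicCylinder r (T, xs))) = ⊤) →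
      ∀ (M : ℝ), 0 ≤ M →
      (∀ t ∈ Set.Ico 0 T, ∀ (R : EuclideanSpace ℝ (Fin 3) ≃ₗᵢ[ℝ] EuclideanSpace ℝ (Fin 3)) (c : ℝ),
          ∫⁻ y : EuclideanSpace ℝ (Fin 2), ‖u t (R (WithLp.toLp 2 ![y 0, y 1, c]))‖ₑ ^ 2 ≤
            ENNReal.ofReal M) →
      ∃ (u₁ : ℝ → EuclideanSpace ℝ (Fin 3) → EuclideanSpace ℝ (Fin 3))
        (p₁ : ℝ → EuclideanSpace ℝ (Fin 3) → ℝ) (g : ℝ → ℝ),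
        Literature.Analysis.FluidPDE.IsClassicalNSSolutionOn (Set.Ioo (-1 : ℝ) 0) 1 0 u₁ p₁ ∧
        ¬ Literature.Analysis.FluidPDE.SereginSverak2009.IsRegularAtOrigin u₁ ∧
        Literature.Analysis.FluidPDE.typeIBound
            (Literature.Analysis.FluidPDE.parabolicCylinder (1 / 2)
              (0 : ℝ × EuclideanSpace ℝ (Fin 3)))
            u₁ (fun t x => p₁ t x - g t) (fun s y => fderiv ℝ (u₁ s) y) < ⊤ ∧
        (∀ t ∈ Set.Ioo (-1 : ℝ) 0,
          ∀ (R : EuclideanSpace ℝ (Fin 3) ≃ₗᵢ[ℝ] EuclideanSpace ℝ (Fin 3)) (c : ℝ),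
          ∫⁻ y : EuclideanSpace ℝ (Fin 2), ‖u₁ t (R (WithLp.toLp 2 ![y 0, y 1, c]))‖ₑ ^ 2 ≤
            ENNReal.ofReal (M / ν ^ 2)) := by
  sorry

/-- STUB 3 (hardest) — the ancient limit in the zoomed frame carrying the planar bound:
`HardyAncientLimit.exists_ancient_of_zoomed` with the planar bound in place of the Hardy bound,
output in the KNSS duality class (`isBoundedAncientMildSolution_of_oseen`), jointly smooth
(`exists_isClassicalNSSolutionOn_Iio_of_oseen`), with planar energies `≤ M` (planar Fatou) and
non-trivial at some negative time (`‖W(0,0)‖ = 1/2` and continuity up to the top). -/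
theorem stub_planarAncientOfZoomed :
    ∀ (u₁ : ℝ → EuclideanSpace ℝ (Fin 3) → EuclideanSpace ℝ (Fin 3))
      (p₁ : ℝ → EuclideanSpace ℝ (Fin 3) → ℝ) (g : ℝ → ℝ) (M : ℝ), 0 ≤ M →
      Literature.Analysis.FluidPDE.IsClassicalNSSolutionOn (Set.Ioo (-1 : ℝ) 0) 1 0 u₁ p₁ →
      ¬ Literature.Analysis.FluidPDE.SereginSverak2009.IsRegularAtOrigin u₁ →
      Literature.Analysis.FluidPDE.typeIBound
          (Literature.Analysis.FluidPDE.parabolicCylinder (1 / 2)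
            (0 : ℝ × EuclideanSpace ℝ (Fin 3)))
          u₁ (fun t x => p₁ t x - g t) (fun s y => fderiv ℝ (u₁ s) y) < ⊤ →
      (∀ t ∈ Set.Ioo (-1 : ℝ) 0,
          ∀ (R : EuclideanSpace ℝ (Fin 3) ≃ₗᵢ[ℝ] EuclideanSpace ℝ (Fin 3)) (c : ℝ),
          ∫⁻ y : EuclideanSpace ℝ (Fin 2), ‖u₁ t (R (WithLp.toLp 2 ![y 0, y 1, c]))‖ₑ ^ 2 ≤
            ENNReal.ofReal M) →
      ∃ (v : ℝ → EuclideanSpace ℝ (Fin 3) → EuclideanSpace ℝ (Fin 3)),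
        Literature.Analysis.FluidPDE.IsBoundedAncientMildSolution 1 v ∧
        (∀ t < 0, MeasureTheory.AEStronglyMeasurable (v t) MeasureTheory.volume) ∧
        ContDiffOn ℝ (⊤ : ℕ∞) (Function.uncurry v) (Set.Iio 0 ×ˢ Set.univ) ∧
        (∀ t < 0, ∀ (R : EuclideanSpace ℝ (Fin 3) ≃ₗᵢ[ℝ] EuclideanSpace ℝ (Fin 3)) (c : ℝ),
          ∫⁻ y : EuclideanSpace ℝ (Fin 2), ‖v t (R (WithLp.toLp 2 ![y 0, y 1, c]))‖ₑ ^ 2 ≤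
            ENNReal.ofReal M) ∧
        ∃ t < 0, ∃ x, v t x ≠ 0 := by
  sorry

/-! ## Glue -/

/-- **The crux `PlanarEnergyZoomA` from the three registered stubs, concluded BY NAME** (pure logic;
the planar bound handed over by the crux hypothesis is made non-negative by `max M 0`). -/
theorem PlanarEnergyZoomA_of :
    Summit.NavierStokesRegularity.NavierStokesRegularity.Theses.PlaneEnergyCeiling.PlanarEnergyZoomA := by
  intro ν hν u₀ hu₀ hdiv hdec hpl hA
  obtain ⟨T, hT, u, p, hcl, hLH, hu0, xs, hsing⟩ := stub_localClaySingularA ν hν u₀ hu₀ hdiv hdec hA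
  obtain ⟨M, hM⟩ := hpl T hT u p hcl hLH hu0
  have hM' : ∀ t ∈ Set.Ico 0 T,
      ∀ (R : EuclideanSpace ℝ (Fin 3) ≃ₗᵢ[ℝ] EuclideanSpace ℝ (Fin 3)) (c : ℝ),
      ∫⁻ y : EuclideanSpace ℝ (Fin 2), ‖u t (R (WithLp.toLp 2 ![y 0, y 1, c]))‖ₑ ^ 2 ≤
        ENNReal.ofReal (max M 0) :=
    fun t ht R c => (hM t ht R c).trans (ENNReal.ofReal_le_ofReal (le_max_left M 0))
  obtain ⟨u₁, p₁, g, hcl₁, hsing₁, hI, hpl₁⟩ :=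
    stub_planarVertexPackage ν T hν hT u p hcl hLH xs hsing (max M 0) (le_max_right M 0) hM'
  have hM0 : 0 ≤ max M 0 / ν ^ 2 := div_nonneg (le_max_right M 0) (pow_nonneg hν.le 2)
  obtain ⟨v, hv, hmeas, hsm, hpv, t, ht, x, hx⟩ :=
    stub_planarAncientOfZoomed u₁ p₁ g (max M 0 / ν ^ 2) hM0 hcl₁ hsing₁ hI hpl₁
  exact ⟨v, max M 0 / ν ^ 2, hv, hmeas, hsm, hpv, t, ht, x, hx⟩

end Summit.NavierStokesRegularity.NavierStokesRegularity.Cruxes.PlanarEnergyZoomA.HardySinkTransfer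

end
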